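import Literature.MathematicalPhysics.QuantumFieldTheory.Balaban1983to89.Node00.LargeFieldTowerOfRecord
import Literature.MathematicalPhysics.QuantumFieldTheory.Balaban1983to89.Node00.RStepRepr218

/-!
# NODE 00 — DEFINER ₇ (R-side), FILE 8: the R-HALF OF THE REPRESENTED TOWER — bridge, slots ∕ slices, `R` of record as a slot operation
# (chair ★★ R437 (2) «then `Rstep` on `RepTower`»; node00-def-T's option (β): their recursion takes `R` as a slot-operation parameter)

What this file adds on top of FILE 5 (`Node00.LargeFieldTowerOfRecord`: the tower of record, `fibOfSeq`, `PpSelOfRecord`) and FILE 7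
(`Node00.RStepRepr218`: `rstepOfSel`, `holds_rstepOfSel`, `integral_sum_rstepOfSel`):

* §1  THE BRIDGE: dag-n12-b's `TowerRep.toRepData` of the tower of record IS FILE 7's `repDataOfSel` of the (2.18) slice of record with the
  tower's selector data (`toRepData_towerRepOfRecord_eq`, `rfl`); `rstepOfRecord` := `rstepOfSel` at the slice of record;
  `holds_rstepOfRecord`; `holds_rstepOfRecord_ROp03AEOfRecord` (on the admissible branch the value of `R` of record v1.1 is represented by
  the R-stepped representation — the clause «𝐑ρ has again the form (2.18)» of Theorem 1 [III] p. 262 at the level of the OBJECTS of record;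
  the shape laws (2.19)–(2.44) are NOT asserted).
* §2  SLOTS AND SLICES: a single-level slot `TexpASlot … p g k := SeqOfRecord … k → Density … k` (the function `s ↦ (𝐓_k e^{A_k})(s)`),
  the slice `sliceOfRecord … k f : Step.Repr218` (FILE 4's `repr218OfRecord` IS the slice of its slot, `rfl`), `densityOfSlice`, the R-step
  ON SLOTS `rstepSlot` with `rstepOfSel_sliceOfRecord : rstepOfSel (sliceOfRecord … f) sel (fibOfSeq …) = sliceOfRecord … (rstepSlot … sel f)`
  (`rfl`) — the R-step never changes the index type, the characters or the regions, only the slot.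
* §3  `R` OF RECORD AS A SLOT OPERATION — **`rstepSlotOfRecord ν τ ppSel : (p g k) → TexpASlot … k → TexpASlot … k`**, exactly the
  shape node00-def-T's represented-tower recursion takes as its parameter `R` (their `SliceOpOfRecord`; the recursion `slot_{k+1} :=
  R (k+1) (tstep k slot_k)`, `slot_0 :=` the one-term start, is THEIRS — this file deliberately carries NO second recursion) — and the three
  identities at an ARBITRARY slot family: `rop_towerRepOfRecord_eq_densityOfSlice` ((0.3) of the tower of record IS the slice density of
  the R-stepped slot — kernel identity), `ROp03AEOfRecord_repOfRecordAE_eq_densityOfSlice` (`R` of record v1.1, the (R3) pin fed the slot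
  family, maps every density a.e.-equal to the represented one to the slice density of the R-stepped slot, under the provisos) and
  `integral_densityOfSlice_rstepSlotOfRecord` ((0.4): equal integrals under the provisos — dag-n23-a's displayed `integral_succ` face ∕
  node00-def's `RepMachine.integral_step`).  Instantiated with the PRE-𝐑 family of the recursion (level `k+1` = `𝐓ρ_k`'s slots) these say:
  `𝐑` of record maps `𝐓ρ_k` to `ρ_{k+1}` and `∫ ρ_{k+1} = ∫ 𝐓ρ_k`.

HONEST FRAMING.  Definitions + `rfl`∕finite-sum bookkeeping + FILE 7's kernel identities (whose only analytic input is b01's PROVED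
fibre lemma under `RepData.Provisos`, displayed as the hypothesis `hprov`).  The slot family `texpA` and the selector `ppSel` are PARAMETERS
(node00-def-T's recursion output and the residual `PpSelOfRecord`); nothing of Bałaban's is asserted — not the provisos, not `IsRT`, not (1.1)∕(1.2),
no estimate, no shape law.  Counts unmoved (typed 28∕28 · discharged 1∕28); nothing continuum ∕ ℝ⁴ ∕ OS ∕ mass-gap ∕ Clay.
No `sorry` ∕ `axiom` ∕ `opaque` ∕ `instance` ∕ `notation`.
-/

namespace Literature.MathematicalPhysics.QuantumFieldTheory.Balaban1983to89.Node00

open MeasureTheory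
open scoped BigOperators
open T4Continuum B14.Eq218Concrete B15RopTotal
open B15.BasicStep (RopReal)

noncomputable section

variable (F : T4Family) (N : ℕ) [NeZero N]

/-! ## §1  The bridge FILE 5 ↔ FILE 7 -/

section Bridge

open Classical in
/-- **The R-stepped (2.18) representation of record at step `k`**: FILE 7's `rstepOfSel` applied to the slice `repr218OfRecord … k` with the
selector of record `ppSel p g k` (residual, A7) and the fibre bond sets `fibOfSeq` of the sequences of record (pure geometry).
[cite: Balaban1989LargeFieldI, (0.3) p.176; Balaban1988Convergent, (2.18) p.257, Theorem 1 p.262 (the clause «has again the form (2.18)»)] -/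
def rstepOfRecord (ν : Stage7Numerics) (τ : TowerNumerics) (texpA : TexpAOfRecord F N ν τ.M) (ppSel : PpSelOfRecord F ν τ.M)
    (p : B12.RunParams) (g : ℕ → ℝ) (k : ℕ) : Step.Repr218 (F.P p.K) (SU N) k :=
  rstepOfSel (repr218OfRecord F N ν τ.M texpA p g k) (ppSel p g k) (fibOfSeq F ν τ p g k)

open Classical in
/-- **BRIDGE** (bookkeeping, `rfl`): dag-n12-b's `TowerRep.toRepData` of the tower of record IS FILE 7's `repDataOfSel` of the (2.18) slice of
record with the tower's selector data. [cite: Balaban1989LargeFieldI, (0.2)–(0.3) p.176 (bookkeeping)] -/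
theorem toRepData_towerRepOfRecord_eq (ν : Stage7Numerics) (τ : TowerNumerics) (texpA : TexpAOfRecord F N ν τ.M)
    (ppSel : PpSelOfRecord F ν τ.M) (p : B12.RunParams) (g : ℕ → ℝ) (k : ℕ) :
    (towerRepOfRecord F N ν τ texpA ppSel p g k).toRepData
      = repDataOfSel (repr218OfRecord F N ν τ.M texpA p g k) (ppSel p g k) (fibOfSeq F ν τ p g k) := rfl

open Classical in
/-- **The R-stepped representation of record represents (0.3) of the tower of record** (FILE 7's kernel identity `holds_rstepOfSel_rop`
through the bridge). [cite: Balaban1989LargeFieldI, (0.3) p.176; Balaban1988Convergent, (2.18) p.257] -/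
theorem holds_rstepOfRecord (ν : Stage7Numerics) (τ : TowerNumerics) (texpA : TexpAOfRecord F N ν τ.M)
    (ppSel : PpSelOfRecord F ν τ.M) (p : B12.RunParams) (g : ℕ → ℝ) (k : ℕ) :
    (rstepOfRecord F N ν τ texpA ppSel p g k).Holds (towerRepOfRecord F N ν τ texpA ppSel p g k).toRepData.rop := by
  rw [toRepData_towerRepOfRecord_eq]
  exact holds_rstepOfSel_rop _ _ _

open Classical in
/-- **On the admissible branch, the value of `R` of record (v1.1, FILE 6) is a (2.18)-represented density, represented by the R-stepped
representation of record** — the clause «𝐑ρ has again the form (2.18)» of Theorem 1 [III] p. 262 at the level of the OBJECTS of record (the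
shape laws (2.19)–(2.44) are NOT asserted here). [cite: Balaban1988Convergent, Theorem 1 p.262, (2.18) p.257; Balaban1989LargeFieldI, (0.3)–(0.4) p.176] -/
theorem holds_rstepOfRecord_ROp03AEOfRecord (ν : Stage7Numerics) (τ : TowerNumerics) (texpA : TexpAOfRecord F N ν τ.M)
    (ppSel : PpSelOfRecord F ν τ.M) (gsel : B12.RunParams → ℕ → ℝ) (p : B12.RunParams) (k : ℕ)
    {ρ : Density (F.P p.K) (k + 1) (SU N)}
    (hae : (towerOfRecord F N ν τ texpA ppSel gsel p k).toRepData.total =ᵐ[fieldMeasure (F.P p.K) (k + 1) (SU N)] ρ)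
    (hprov : (towerOfRecord F N ν τ texpA ppSel gsel p k).toRepData.Provisos) :
    (rstepOfRecord F N ν τ texpA ppSel p (gsel p) (k + 1)).Holds
      (ROp03AEOfRecord F N (repOfRecordAE F N ν τ texpA ppSel gsel) p k ρ) := by
  rw [ROp03AEOfRecord_repOfRecordAE_of_ae F N ν τ texpA ppSel gsel p k hae hprov]
  exact holds_rstepOfRecord F N ν τ texpA ppSel p (gsel p) (k + 1)

end Bridge

/-! ## §2  Slots and slices -/

section Slices

/-- A single-level SLOT: the function `s ↦ (𝐓_k e^{A_k})(s)` of (2.18) at run `p`, couplings `g`, step `k` (a `TexpAOfRecord` is a family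
of slots). [cite: Balaban1988Convergent, (2.18) p.257] -/
abbrev TexpASlot (ν : Stage7Numerics) (M : ℕ) (p : B12.RunParams) (g : ℕ → ℝ) (k : ℕ) : Type :=
  SeqOfRecord F ν M g p.K k → Density (F.P p.K) k (SU N)

/-- **The (2.18) slice of record with a given slot**: index = sequences of record, `χ` = `chiSeqOfRecord`, `Z_k = Λ_kᶜ`, `𝐓e^A` = the slot
`f`. [cite: Balaban1988Convergent, (2.18) p.257, (2.3) p.255] -/
def sliceOfRecord (ν : Stage7Numerics) (M : ℕ) (p : B12.RunParams) (g : ℕ → ℝ) (k : ℕ) (f : TexpASlot F N ν M p g k) :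
    Step.Repr218 (F.P p.K) (SU N) k where
  Adm := SeqOfRecord F ν M g p.K k
  Zs := Set (Site (F.P p.K) 0)
  finZs := Fintype.ofFinite _
  decZs := Classical.decEq _
  χ := chiSeqOfRecord F N ν M g p.K k
  TexpA := f
  lastZ s := (s.Λ k)ᶜ

/-- FILE 4's representation of record IS the slice of its slot (`rfl`). [cite: Balaban1988Convergent, (2.18) p.257 (bookkeeping)] -/
theorem repr218OfRecord_eq_sliceOfRecord (ν : Stage7Numerics) (M : ℕ) (texpA : TexpAOfRecord F N ν M) (p : B12.RunParams)
    (g : ℕ → ℝ) (k : ℕ) : repr218OfRecord F N ν M texpA p g k = sliceOfRecord F N ν M p g k (texpA p g k) := rfl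

/-- The density assembled from a slice: `Σ_s χ_k(s)(V) · f(s)(V)`. [cite: Balaban1988Convergent, (2.18) p.257] -/
def densityOfSlice (ν : Stage7Numerics) (M : ℕ) (p : B12.RunParams) (g : ℕ → ℝ) (k : ℕ) (f : TexpASlot F N ν M p g k) :
    Density (F.P p.K) k (SU N) :=
  fun V => ∑ s : SeqOfRecord F ν M g p.K k, chiSeqOfRecord F N ν M g p.K k s V * f s V

/-- FILE 4's assembled density IS the slice density of its slot (`rfl`). [cite: Balaban1988Convergent, (2.18) p.257 (bookkeeping)] -/
theorem densityOfRepr_eq_densityOfSlice (ν : Stage7Numerics) (M : ℕ) (texpA : TexpAOfRecord F N ν M) (p : B12.RunParams)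
    (g : ℕ → ℝ) (k : ℕ) : densityOfRepr F N ν M texpA p g k = densityOfSlice F N ν M p g k (texpA p g k) := rfl

/-- The slice represents its assembled density ((2.18) by construction). [cite: Balaban1988Convergent, (2.18) p.257 (bookkeeping)] -/
theorem holds_densityOfSlice (ν : Stage7Numerics) (M : ℕ) (p : B12.RunParams) (g : ℕ → ℝ) (k : ℕ) (f : TexpASlot F N ν M p g k) :
    (sliceOfRecord F N ν M p g k f).Holds (densityOfSlice F N ν M p g k f) := fun _ => rfl

open Classical in
/-- **The R-step ON SLOTS**: the slot of the R-stepped slice — `(𝐓e^A)′(s′) := (𝐓e^A)(s′) · Σ_{s ∈ sel⁻¹ s′} (fibre-integral ratio)`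
(FILE 7 `rstepOfSel_TexpA`), with the fibre bond sets `fibOfSeq` of the sequences of record. [cite: Balaban1989LargeFieldI, (0.3) p.176] -/
def rstepSlot (ν : Stage7Numerics) (τ : TowerNumerics) (p : B12.RunParams) (g : ℕ → ℝ) (k : ℕ)
    (sel : SeqOfRecord F ν τ.M g p.K k → SeqOfRecord F ν τ.M g p.K k) (f : TexpASlot F N ν τ.M p g k) : TexpASlot F N ν τ.M p g k :=
  (rstepOfSel (sliceOfRecord F N ν τ.M p g k f) sel (fibOfSeq F ν τ p g k)).TexpA

open Classical in
/-- **The R-step never changes the index type, the characters or the regions — only the slot** (`rfl`): the R-stepped slice is the slice of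
the R-stepped slot. [cite: Balaban1989LargeFieldI, (0.3) p.176 (bookkeeping); Balaban1988Convergent, Theorem 1 p.262 («has again the form (2.18)»)] -/
theorem rstepOfSel_sliceOfRecord (ν : Stage7Numerics) (τ : TowerNumerics) (p : B12.RunParams) (g : ℕ → ℝ) (k : ℕ)
    (sel : SeqOfRecord F ν τ.M g p.K k → SeqOfRecord F ν τ.M g p.K k) (f : TexpASlot F N ν τ.M p g k) :
    rstepOfSel (sliceOfRecord F N ν τ.M p g k f) sel (fibOfSeq F ν τ p g k)
      = sliceOfRecord F N ν τ.M p g k (rstepSlot F N ν τ p g k sel f) := rfl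

open Classical in
/-- `rstepOfRecord` is the slice of the R-stepped slot of record (`rfl`). [cite: Balaban1989LargeFieldI, (0.3) p.176 (bookkeeping)] -/
theorem rstepOfRecord_eq_sliceOfRecord (ν : Stage7Numerics) (τ : TowerNumerics) (texpA : TexpAOfRecord F N ν τ.M)
    (ppSel : PpSelOfRecord F ν τ.M) (p : B12.RunParams) (g : ℕ → ℝ) (k : ℕ) :
    rstepOfRecord F N ν τ texpA ppSel p g k = sliceOfRecord F N ν τ.M p g k (rstepSlot F N ν τ p g k (ppSel p g k) (texpA p g k)) :=
  rfl

end Slices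

/-! ## §3  `R` of record as a slot operation, and the (0.3) ∕ (0.4) ∕ `R`-identities at an arbitrary slot family -/

section SlotIdentities

variable (ν : Stage7Numerics) (τ : TowerNumerics)

open Classical in
/-- **`R` of record AS A SLOT OPERATION** (the shape node00-def-T's represented-tower recursion takes as its parameter `R : SliceOpOfRecord`): at run `p`, couplings `g`, step `k`, the slot `f` goes to the slot of the R-stepped slice, with the selector of
record `ppSel p g k` and the fibre bond sets `fibOfSeq` of the sequences of record. [cite: Balaban1989LargeFieldI, (0.3) p.176] -/
def rstepSlotOfRecord (ppSel : PpSelOfRecord F ν τ.M) :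
    (p : B12.RunParams) → (g : ℕ → ℝ) → (k : ℕ) → TexpASlot F N ν τ.M p g k → TexpASlot F N ν τ.M p g k :=
  fun p g k => rstepSlot F N ν τ p g k (ppSel p g k)

open Classical in
/-- The slot of the R-stepped representation of record is `R` of record (as a slot operation) applied to the slot (`rfl`).
[cite: Balaban1989LargeFieldI, (0.3) p.176 (bookkeeping)] -/
theorem rstepOfRecord_TexpA (texpA : TexpAOfRecord F N ν τ.M) (ppSel : PpSelOfRecord F ν τ.M) (p : B12.RunParams)
    (g : ℕ → ℝ) (k : ℕ) :
    (rstepOfRecord F N ν τ texpA ppSel p g k).TexpA = rstepSlotOfRecord F N ν τ ppSel p g k (texpA p g k) := rfl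

open Classical in
/-- **(0.3) of the tower of record IS the slice density of the R-stepped slot** (kernel identity, from FILE 7's `holds_rstepOfSel`), for an
ARBITRARY slot family `texpA` (instantiate with the PRE-𝐑 family of node00-def-T's recursion: then the right side is `ρ_{k}` of the
recursion by their `texpAOfRecord_succ`). [cite: Balaban1989LargeFieldI, (0.3) p.176; Balaban1988Convergent, (2.18) p.257] -/
theorem rop_towerRepOfRecord_eq_densityOfSlice (texpA : TexpAOfRecord F N ν τ.M) (ppSel : PpSelOfRecord F ν τ.M)
    (p : B12.RunParams) (g : ℕ → ℝ) (k : ℕ) :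
    (towerRepOfRecord F N ν τ texpA ppSel p g k).toRepData.rop
      = densityOfSlice F N ν τ.M p g k (rstepSlotOfRecord F N ν τ ppSel p g k (texpA p g k)) :=
  (holds_iff_eq_sum_rterm _ _).1 (holds_rstepOfRecord F N ν τ texpA ppSel p g k)

open Classical in
/-- **`R` of record maps the represented density of a slot family to the slice density of its R-stepped slot**: with FILE 5's (R3) pin
`repOfRecordAE` fed the slot family `texpA` (node00-def-T: the PRE-𝐑 family, level `k+1` = `𝐓ρ_k`'s slots), `R` of record (v1.1, FILE 6
`ROp03AEOfRecord`) sends every density a.e.-equal to the represented density at level `k+1` to the slice density of the R-stepped slot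
(= `ρ_{k+1}` of the recursion), under the provisos of p. 176. [cite: Balaban1989LargeFieldI, (0.3)–(0.4) p.176; Balaban1988Convergent, Theorem 1 p.262] -/
theorem ROp03AEOfRecord_repOfRecordAE_eq_densityOfSlice (texpA : TexpAOfRecord F N ν τ.M) (ppSel : PpSelOfRecord F ν τ.M)
    (gsel : B12.RunParams → ℕ → ℝ) (p : B12.RunParams) (k : ℕ) {ρ : Density (F.P p.K) (k + 1) (SU N)}
    (hae : (towerOfRecord F N ν τ texpA ppSel gsel p k).toRepData.total =ᵐ[fieldMeasure (F.P p.K) (k + 1) (SU N)] ρ)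
    (hprov : (towerOfRecord F N ν τ texpA ppSel gsel p k).toRepData.Provisos) :
    ROp03AEOfRecord F N (repOfRecordAE F N ν τ texpA ppSel gsel) p k ρ
      = densityOfSlice F N ν τ.M p (gsel p) (k + 1)
          (rstepSlotOfRecord F N ν τ ppSel p (gsel p) (k + 1) (texpA p (gsel p) (k + 1))) := by
  rw [ROp03AEOfRecord_repOfRecordAE_of_ae F N ν τ texpA ppSel gsel p k hae hprov]
  exact rop_towerRepOfRecord_eq_densityOfSlice F N ν τ texpA ppSel p (gsel p) (k + 1)

open Classical in
/-- **(0.4) at a slot family** — dag-n23-a's displayed `integral_succ` face ∕ node00-def's `RepMachine.integral_step`: under the provisos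
of the tower of record at level `k`, the slice density of the R-stepped slot and the represented density of the slot have equal integrals
(FILE 7 `integral_sum_rstepOfSel`, whose one analytic input is b01's PROVED fibre lemma). [cite: Balaban1989LargeFieldI, (0.4) p.176] -/
theorem integral_densityOfSlice_rstepSlotOfRecord (texpA : TexpAOfRecord F N ν τ.M) (ppSel : PpSelOfRecord F ν τ.M)
    (p : B12.RunParams) (g : ℕ → ℝ) (k : ℕ) (hprov : (towerRepOfRecord F N ν τ texpA ppSel p g k).toRepData.Provisos) :
    ∫ V, densityOfSlice F N ν τ.M p g k (rstepSlotOfRecord F N ν τ ppSel p g k (texpA p g k)) V ∂(fieldMeasure (F.P p.K) k (SU N))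
      = ∫ V, densityOfRepr F N ν τ.M texpA p g k V ∂(fieldMeasure (F.P p.K) k (SU N)) :=
  integral_sum_rstepOfSel (repr218OfRecord F N ν τ.M texpA p g k) (ppSel p g k) (fibOfSeq F ν τ p g k) hprov

end SlotIdentities

end

end Literature.MathematicalPhysics.QuantumFieldTheory.Balaban1983to89.Node00
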